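import Literature.Geometry.Lorentzian.KerrStarMorawetzCurrent
import HarnessLib

/-!
# A globally non-negative physical-space Morawetz current for axisymmetric waves on extremal
# Kerr, regular across the horizon: the seed `f = (r² − 2Mr − M²)/(r² + M²)`, a Lagrangian bump,
# a Hardy one-form `¼ψ² v ∂_r`, and the positivity certificates

(family `gr`; namespace `Literature.Geometry.Lorentzian.Kerr.StarCoord`; written from the proving
seat of `Literature.Barriers.FinalStateConjecture.Aretakis2012_pointwiseDecay` — Aretakis, JFA 263
(2012), Thm. 5 — which by `ExtremalHorizonPointwiseDecayFromILED.lean` rests on ONE input: the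
integrated local energy decay statement of Thm. 1 of the source restricted to a compact slab
`{23M/21 ≤ r ≤ 8M/7}`. The source proves Thm. 1 by frequency-localised currents (§§8–12) and notes
(§1.2.2) that for axisymmetric `ψ` "one could in principle expect to derive integrated decay … using
purely classical currents; this remains however an open problem". Giorgi–Wan (JFA 287 (2024) 110668,
arXiv:2212.13164, Thm. 1.1 and Cor. 1.2) address it with one classical current
`𝒫^{(X, w, J)}_μ = Q_{μν}X^ν + ½wψ∂_μψ − ¼(∂_μw)ψ² + ¼J_μψ²`, `X = zu ∂_r^{BL} = (u/(r²+M²))∂_{r*}`,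
`w = z∂_r u`, `J = v∂_r` (their §§3.3–4.2, adapting Stogin's sub-extremal construction). **This file
carries out such a construction in the coordinates `(t*, r, θ, φ*)` of the catalogue, with profiles
that are smooth up to and across `𝓗⁺`, and PROVES the pointwise non-negativity of the bulk on the
whole exterior `{r ≥ M}` together with its coercivity on the slab.**

Design (everything explicit and rational in `r`; `R2 = r² + M²`, `Δ = (r − M)²`,
`X = Δ∂_rG + 2Mr∂_{t*}G = Δ·∂_r^{BL}ψ`, `Σ = r² + M²cos²θ`):

* seed `f = gwSeed M = (r² − 2Mr − M²)/R2` (`u = R2·f = r² − 2Mr − M²` vanishes exactly on the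
  effective photon sphere `r = (1 + √2)M`; `f(M) = −1`, `f → 1`, `f' = 2M(r² + 2Mr − M²)/R2² > 0`),
  fed to the Morawetz current of `KerrStarMorawetzCurrent.lean` (`X = f∂_{r*}`, Lagrangian
  `mzProfileW = (r − M)³/R2²`): first square `(f'/R2)X²`, angular term
  `A(G_θ² + M²sin²θ G_t²)`, `A = (r − M)(r² − 2Mr − M²)²/R2³ ≥ 0`, zeroth-order coefficient
  `C_f = 4M(M⁶ + 2M⁵r − 11M⁴r² + 10M³r³ + M²r⁴ − 4Mr⁵ + r⁶)/R2⁴` (of both signs: for every seed smooth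
  at `r = M` the coefficient `C_f = −¼(Δ(z u')')'` cannot be signed on `(M, ∞)` — hence the next two
  items; Giorgi–Wan instead take `u ∼ −M³/(r − M)`, singular at `𝓗⁺`);
* a Lagrangian bump `−b`, `b = gwBump M = (M/20)Δ(r² − 2Mr − M²)²/R2⁴`, whose bulk supplies
  `(∂_{t*}G)²` at the poles (Giorgi–Wan's `w_T`, §4.2);
* the Hardy one-form `J = ¼ψ² v ∂_r^{BL}`, `v = Δ·ṽ`, `ṽ = gwJ M = 7Mr²(r − M)/R2⁴`, with densities
  `jDensity = ½MrΣ sin θ ṽ G²`, `jFluxR = ¼ΣΔ sin θ ṽ G²` (vanishing on `𝓗⁺`) and bulk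
  `jBulk = sin θ[½ΣṽGX + ¼(Σ(Δṽ)' + 2rΔṽ)G²]` (`j_identity`: product rule only) — Giorgi–Wan's
  global Hardy inequality (§4.2) in divergence form, with a profile regular at `𝓗⁺`.

Main results: `gwGood_eq` — the total bulk `−multBulk(f̃, h̃, mzProfileW − b) + jBulk` equals
`sin θ · gwQuad(r, cos θ, G, ∂G)` for an explicit quadratic form; `gwQuad_nonneg` — `gwQuad ≥ 0` for
`r ≥ M`, `cos²θ ≤ 1` (the `(X, G)`-block `αX² + κXG + γG²`, `α = (9/10)f'/R2 − b/Δ`, `κ = ½Σṽ`, is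
handled by `4α(…) = (2αX + κG)² + (4αγ − κ²)G²` and the CERTIFICATES `gwCert_low/high`:
`4αγ − κ²` at `Σ = r²` and `Σ = R2` are `R2⁻¹⁰ Σ_{k=2}^{14} a_k (r − M)^k M^{16−k}` with all
`a_k ≥ 0`, and `4αγ − κ²` is concave in `Σ`); `gwQuad_slab` — on `23M/21 ≤ r ≤ 8M/7`,
`gwQuad ≥ 10⁻⁸M⁻²(MG² + M³((∂_{t*}G)² + (∂_rG)²) + M(∂_θG)²)`; the box identity `j_box_identity`;
smoothness of all profiles; the horizon values. Everything is proved; no named facts.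

## References

* E. Giorgi, J. Wan, *Physical-space estimates for axisymmetric waves on extremal Kerr spacetime*,
  J. Funct. Anal. 287 (2024) 110668 (arXiv:2212.13164): §1.2, Lemma 3.2, §3.4, §4.1 (`z`, `u`,
  `w`, the trapping polynomial `𝒯 = (r − M)(r² − 2Mr − M²)`), §4.2 (the Hardy one-form `J = v∂_r`,
  the time-derivative bump `w_T`) (key `GiorgiWan2024`).
* S. Aretakis, *Decay of axisymmetric solutions of the wave equation on extreme Kerr backgrounds*,
  J. Funct. Anal. 263 (2012) 2770–2831 (arXiv:1110.2006): §1.2.2, Thm. 1, Prop. 12.5.1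
  (key `Aretakis2012`).
* J. Stogin, *Nonlinear wave dynamics in black hole spacetimes*, PhD thesis, Princeton (2017),
  Lemma 5.2.6 — cited through Giorgi–Wan, §4.1.
-/

noncomputable section

open Real Set Filter
open scoped Topology ContDiff

namespace Literature.Geometry.Lorentzian

namespace Kerr

namespace StarCoord

/-! ### The seed and its derivatives -/

/-- The seed `f = (r² − 2Mr − M²)/(r² + M²)` of the Morawetz field `X = f∂_{r*}`
(`u = (r² + M²)f = r² − 2Mr − M²`, cf. Giorgi–Wan's `X = zu∂_r`, `u(r_trap) = 0`).
[cite: GiorgiWan2024, §4.1] -/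
def gwSeed (M : ℝ) : ℝ → ℝ := fun r ↦ (r ^ 2 - 2 * M * r - M ^ 2) / (r ^ 2 + M ^ 2)

/-- `f'` in closed form: `2M(r² + 2Mr − M²)/(r² + M²)²`. [cite: GiorgiWan2024, §4.1] -/
def gwSeed₁ (M : ℝ) : ℝ → ℝ := fun r ↦
  (-2 * M ^ 3 + 4 * M ^ 2 * r + 2 * M * r ^ 2) / (r ^ 2 + M ^ 2) ^ 2

/-- `f''` in closed form. [cite: GiorgiWan2024, §4.1] -/
def gwSeed₂ (M : ℝ) : ℝ → ℝ := fun r ↦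
  (4 * M ^ 4 + 12 * M ^ 3 * r - 12 * M ^ 2 * r ^ 2 - 4 * M * r ^ 3) / (r ^ 2 + M ^ 2) ^ 3

/-- `f'''` in closed form. [cite: GiorgiWan2024, §4.1] -/
def gwSeed₃ (M : ℝ) : ℝ → ℝ := fun r ↦
  (12 * M ^ 5 - 48 * M ^ 4 * r - 72 * M ^ 3 * r ^ 2 + 48 * M ^ 2 * r ^ 3 + 12 * M * r ^ 4) /
    (r ^ 2 + M ^ 2) ^ 4

/-- The Lagrangian bump `b = (M/20)(r − M)²(r² − 2Mr − M²)²/(r² + M²)⁴` (subtracted from the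
Lagrangian profile; it supplies `(∂_{t*}G)²` at the poles, cf. Giorgi–Wan's `w_T`).
[cite: GiorgiWan2024, §4.2] -/
def gwBump (M : ℝ) : ℝ → ℝ := fun r ↦
  M / 20 * (r - M) ^ 2 * (r ^ 2 - 2 * M * r - M ^ 2) ^ 2 / (r ^ 2 + M ^ 2) ^ 4

/-- `b'` in closed form. [cite: GiorgiWan2024, §4.2] -/
def gwBump₁ (M : ℝ) : ℝ → ℝ := fun r ↦
  (1 / 10 * M ^ 8 - 9 / 10 * M ^ 7 * r - 13 / 10 * M ^ 6 * r ^ 2 + 37 / 10 * M ^ 5 * r ^ 3 -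
    1 / 2 * M ^ 4 * r ^ 4 - 19 / 10 * M ^ 3 * r ^ 5 + 9 / 10 * M ^ 2 * r ^ 6 - 1 / 10 * M * r ^ 7) /
    (r ^ 2 + M ^ 2) ^ 5

/-- `b''` in closed form. [cite: GiorgiWan2024, §4.2] -/
def gwBump₂ (M : ℝ) : ℝ → ℝ := fun r ↦
  (-(9 / 10) * M ^ 9 - 18 / 5 * M ^ 8 * r + 96 / 5 * M ^ 7 * r ^ 2 + 42 / 5 * M ^ 6 * r ^ 3 -
    177 / 5 * M ^ 5 * r ^ 4 + 42 / 5 * M ^ 4 * r ^ 5 + 44 / 5 * M ^ 3 * r ^ 6 - 18 / 5 * M ^ 2 * r ^ 7 +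
    3 / 10 * M * r ^ 8) / (r ^ 2 + M ^ 2) ^ 6

/-- The Lagrangian profile actually used: `mzProfileW − b` (`mzProfileW = (r − M)³/(r² + M²)²` for
the seed `gwSeed`). [cite: GiorgiWan2024, §4.1–4.2] -/
def gwLag (M : ℝ) : ℝ → ℝ := fun r ↦ mzProfileW M (gwSeed M) (gwSeed₁ M) r - gwBump M r

/-- The Hardy profile `ṽ = 7Mr²(r − M)/(r² + M²)⁴` of the one-form `J = ¼ψ²(Δṽ)∂_r^{BL}`
(Giorgi–Wan's `J = v∂_r`, here with `v = Δṽ` regular and vanishing at `𝓗⁺`).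
[cite: GiorgiWan2024, §4.2] -/
def gwJ (M : ℝ) : ℝ → ℝ := fun r ↦ 7 * M * r ^ 2 * (r - M) / (r ^ 2 + M ^ 2) ^ 4

/-- `ṽ'` in closed form. [cite: GiorgiWan2024, §4.2] -/
def gwJ₁ (M : ℝ) : ℝ → ℝ := fun r ↦
  (-14 * M ^ 4 * r + 21 * M ^ 3 * r ^ 2 + 42 * M ^ 2 * r ^ 3 - 35 * M * r ^ 4) / (r ^ 2 + M ^ 2) ^ 5

section Derivatives

variable {M : ℝ}

/-- `(R2^(k+1))' = (k+1) R2^k · 2r`. [folklore] -/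
theorem hasDerivAt_R2pow (M r : ℝ) (k : ℕ) :
    HasDerivAt (fun x : ℝ ↦ (x ^ 2 + M ^ 2) ^ (k + 1)) ((k + 1) * (r ^ 2 + M ^ 2) ^ k * (2 * r)) r := by
  have h := (hasDerivAt_R2 M r).fun_pow (k + 1)
  exact h.congr_deriv (by push_cast; ring)

/-- Derivative of the numerator of the seed. [folklore] -/
theorem hasDerivAt_gwSeed_num (M r : ℝ) :
    HasDerivAt (fun x : ℝ ↦ x ^ 2 - 2 * M * x - M ^ 2) (2 * r - 2 * M) r := by
  have h := (((hasDerivAt_id' r).fun_pow 2).fun_sub ((hasDerivAt_id' r).const_mul (2 * M))).sub_const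
    (M ^ 2)
  exact h.congr_deriv (by ring)

/-- `f' = gwSeed₁`. [cite: GiorgiWan2024, §4.1] -/
theorem hasDerivAt_gwSeed (hM : M ≠ 0) (r : ℝ) : HasDerivAt (gwSeed M) (gwSeed₁ M r) r := by
  have hR := (R2_pos hM r).ne'
  have h := (hasDerivAt_gwSeed_num M r).div (hasDerivAt_R2 M r) hR
  refine h.congr_deriv ?_
  simp only [gwSeed₁]
  field_simp
  ring

/-- Derivative of the numerator of `gwSeed₁`. [folklore] -/
theorem hasDerivAt_gwSeed₁_num (M r : ℝ) :
    HasDerivAt (fun x : ℝ ↦ -2 * M ^ 3 + 4 * M ^ 2 * x + 2 * M * x ^ 2) (4 * M ^ 2 + 4 * M * r) r := by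
  have h := (((hasDerivAt_id' r).const_mul (4 * M ^ 2)).const_add (-2 * M ^ 3)).fun_add
    (((hasDerivAt_id' r).fun_pow 2).const_mul (2 * M))
  exact h.congr_deriv (by ring)

/-- `f'' = gwSeed₂`. [cite: GiorgiWan2024, §4.1] -/
theorem hasDerivAt_gwSeed₁ (hM : M ≠ 0) (r : ℝ) : HasDerivAt (gwSeed₁ M) (gwSeed₂ M r) r := by
  have hR := (R2_pos hM r).ne'
  have h := (hasDerivAt_gwSeed₁_num M r).div (hasDerivAt_R2pow M r 1) (pow_ne_zero _ hR)
  refine h.congr_deriv ?_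
  simp only [gwSeed₂]
  field_simp
  ring

/-- Derivative of the numerator of `gwSeed₂`. [folklore] -/
theorem hasDerivAt_gwSeed₂_num (M r : ℝ) :
    HasDerivAt (fun x : ℝ ↦ 4 * M ^ 4 + 12 * M ^ 3 * x - 12 * M ^ 2 * x ^ 2 - 4 * M * x ^ 3)
      (12 * M ^ 3 - 24 * M ^ 2 * r - 12 * M * r ^ 2) r := by
  have h := ((((hasDerivAt_id' r).const_mul (12 * M ^ 3)).const_add (4 * M ^ 4)).fun_sub
    (((hasDerivAt_id' r).fun_pow 2).const_mul (12 * M ^ 2))).fun_sub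
    (((hasDerivAt_id' r).fun_pow 3).const_mul (4 * M))
  exact h.congr_deriv (by ring)

/-- `f''' = gwSeed₃`. [cite: GiorgiWan2024, §4.1] -/
theorem hasDerivAt_gwSeed₂ (hM : M ≠ 0) (r : ℝ) : HasDerivAt (gwSeed₂ M) (gwSeed₃ M r) r := by
  have hR := (R2_pos hM r).ne'
  have h := (hasDerivAt_gwSeed₂_num M r).div (hasDerivAt_R2pow M r 2) (pow_ne_zero _ hR)
  refine h.congr_deriv ?_
  simp only [gwSeed₃]
  field_simp
  ring

/-- Derivative of the numerator of the bump. [folklore] -/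
theorem hasDerivAt_gwBump_num (M r : ℝ) :
    HasDerivAt (fun x : ℝ ↦ M / 20 * (x - M) ^ 2 * (x ^ 2 - 2 * M * x - M ^ 2) ^ 2)
      (M / 20 * (2 * (r - M)) * (r ^ 2 - 2 * M * r - M ^ 2) ^ 2 +
        M / 20 * (r - M) ^ 2 * (2 * (r ^ 2 - 2 * M * r - M ^ 2) * (2 * r - 2 * M))) r := by
  have h1 := (((hasDerivAt_id' r).sub_const M).fun_pow 2).const_mul (M / 20)
  have h2 := (hasDerivAt_gwSeed_num M r).fun_pow 2
  have h := h1.fun_mul h2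
  exact h.congr_deriv (by push_cast; ring)

/-- `b' = gwBump₁`. [cite: GiorgiWan2024, §4.2] -/
theorem hasDerivAt_gwBump (hM : M ≠ 0) (r : ℝ) : HasDerivAt (gwBump M) (gwBump₁ M r) r := by
  have hR := (R2_pos hM r).ne'
  have h := (hasDerivAt_gwBump_num M r).div (hasDerivAt_R2pow M r 3) (pow_ne_zero _ hR)
  refine h.congr_deriv ?_
  simp only [gwBump₁]
  field_simp
  ring

/-- Derivative of the numerator of `gwBump₁`. [folklore] -/
theorem hasDerivAt_gwBump₁_num (M r : ℝ) :
    HasDerivAt (fun x : ℝ ↦ 1 / 10 * M ^ 8 - 9 / 10 * M ^ 7 * x - 13 / 10 * M ^ 6 * x ^ 2 +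
        37 / 10 * M ^ 5 * x ^ 3 - 1 / 2 * M ^ 4 * x ^ 4 - 19 / 10 * M ^ 3 * x ^ 5 + 9 / 10 * M ^ 2 * x ^ 6 -
        1 / 10 * M * x ^ 7)
      (-(9 / 10) * M ^ 7 - 13 / 5 * M ^ 6 * r + 111 / 10 * M ^ 5 * r ^ 2 - 2 * M ^ 4 * r ^ 3 -
        19 / 2 * M ^ 3 * r ^ 4 + 27 / 5 * M ^ 2 * r ^ 5 - 7 / 10 * M * r ^ 6) r := by
  have h := ((((((((hasDerivAt_id' r).const_mul (9 / 10 * M ^ 7)).const_sub (1 / 10 * M ^ 8)).fun_sub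
    (((hasDerivAt_id' r).fun_pow 2).const_mul (13 / 10 * M ^ 6))).fun_add
    (((hasDerivAt_id' r).fun_pow 3).const_mul (37 / 10 * M ^ 5))).fun_sub
    (((hasDerivAt_id' r).fun_pow 4).const_mul (1 / 2 * M ^ 4))).fun_sub
    (((hasDerivAt_id' r).fun_pow 5).const_mul (19 / 10 * M ^ 3))).fun_add
    (((hasDerivAt_id' r).fun_pow 6).const_mul (9 / 10 * M ^ 2))).fun_sub
    (((hasDerivAt_id' r).fun_pow 7).const_mul (1 / 10 * M))
  exact h.congr_deriv (by push_cast; ring)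

/-- `b'' = gwBump₂`. [cite: GiorgiWan2024, §4.2] -/
theorem hasDerivAt_gwBump₁ (hM : M ≠ 0) (r : ℝ) : HasDerivAt (gwBump₁ M) (gwBump₂ M r) r := by
  have hR := (R2_pos hM r).ne'
  have h := (hasDerivAt_gwBump₁_num M r).div (hasDerivAt_R2pow M r 4) (pow_ne_zero _ hR)
  refine h.congr_deriv ?_
  simp only [gwBump₂]
  field_simp
  ring

/-- Derivative of the numerator of `gwJ`. [folklore] -/
theorem hasDerivAt_gwJ_num (M r : ℝ) :
    HasDerivAt (fun x : ℝ ↦ 7 * M * x ^ 2 * (x - M)) (7 * M * (2 * r) * (r - M) + 7 * M * r ^ 2) r := by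
  have h := (((hasDerivAt_id' r).fun_pow 2).const_mul (7 * M)).fun_mul ((hasDerivAt_id' r).sub_const M)
  exact h.congr_deriv (by push_cast; ring)

/-- `ṽ' = gwJ₁`. [cite: GiorgiWan2024, §4.2] -/
theorem hasDerivAt_gwJ (hM : M ≠ 0) (r : ℝ) : HasDerivAt (gwJ M) (gwJ₁ M r) r := by
  have hR := (R2_pos hM r).ne'
  have h := (hasDerivAt_gwJ_num M r).div (hasDerivAt_R2pow M r 3) (pow_ne_zero _ hR)
  refine h.congr_deriv ?_
  simp only [gwJ₁]
  field_simp
  ring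

end Derivatives

/-! ### Smoothness of the profiles -/

section Smoothness

variable {M : ℝ}

/-- The seed is smooth. [folklore] -/
theorem contDiff_gwSeed (hM : M ≠ 0) : ContDiff ℝ ∞ (gwSeed M) := by
  unfold gwSeed
  fun_prop (disch := intro x; exact (R2_pos hM x).ne')

/-- `gwSeed₁` is smooth. [folklore] -/
theorem contDiff_gwSeed₁ (hM : M ≠ 0) : ContDiff ℝ ∞ (gwSeed₁ M) := by
  unfold gwSeed₁
  fun_prop (disch := intro x; exact pow_ne_zero _ (R2_pos hM x).ne')

/-- `gwSeed₂` is smooth. [folklore] -/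
theorem contDiff_gwSeed₂ (hM : M ≠ 0) : ContDiff ℝ ∞ (gwSeed₂ M) := by
  unfold gwSeed₂
  fun_prop (disch := intro x; exact pow_ne_zero _ (R2_pos hM x).ne')

/-- The bump is smooth. [folklore] -/
theorem contDiff_gwBump (hM : M ≠ 0) : ContDiff ℝ ∞ (gwBump M) := by
  unfold gwBump
  fun_prop (disch := intro x; exact pow_ne_zero _ (R2_pos hM x).ne')

/-- `gwBump₁` is smooth. [folklore] -/
theorem contDiff_gwBump₁ (hM : M ≠ 0) : ContDiff ℝ ∞ (gwBump₁ M) := by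
  unfold gwBump₁
  fun_prop (disch := intro x; exact pow_ne_zero _ (R2_pos hM x).ne')

/-- The Hardy profile is smooth. [folklore] -/
theorem contDiff_gwJ (hM : M ≠ 0) : ContDiff ℝ ∞ (gwJ M) := by
  unfold gwJ
  fun_prop (disch := intro x; exact pow_ne_zero _ (R2_pos hM x).ne')

/-- The `∂_r`-profile `mzProfileR M (gwSeed M)` is smooth. [folklore] -/
theorem contDiff_mzProfileR_gw (hM : M ≠ 0) : ContDiff ℝ ∞ (mzProfileR M (gwSeed M)) := by
  unfold mzProfileR gwSeed
  fun_prop (disch := intro x; exact (R2_pos hM x).ne')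

/-- The `∂_{t*}`-profile `mzProfileT M (gwSeed M)` is smooth. [folklore] -/
theorem contDiff_mzProfileT_gw (hM : M ≠ 0) : ContDiff ℝ ∞ (mzProfileT M (gwSeed M)) := by
  unfold mzProfileT gwSeed
  fun_prop (disch := intro x; exact (R2_pos hM x).ne')

/-- The Lagrangian profile `mzProfileW M (gwSeed M) (gwSeed₁ M)` is smooth. [folklore] -/
theorem contDiff_mzProfileW_gw (hM : M ≠ 0) : ContDiff ℝ ∞ (mzProfileW M (gwSeed M) (gwSeed₁ M)) := by
  unfold mzProfileW gwSeed gwSeed₁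
  fun_prop (disch := intro x; first
    | exact pow_ne_zero _ (R2_pos hM x).ne'
    | exact (R2_pos hM x).ne')

/-- Its raw derivative `mzProfileW'` is smooth. [folklore] -/
theorem contDiff_mzProfileW'_gw (hM : M ≠ 0) :
    ContDiff ℝ ∞ (mzProfileW' M (gwSeed M) (gwSeed₁ M) (gwSeed₂ M)) := by
  unfold mzProfileW' gwSeed gwSeed₁ gwSeed₂
  fun_prop (disch := intro x; first
    | exact pow_ne_zero _ (pow_ne_zero _ (R2_pos hM x).ne')
    | exact pow_ne_zero _ (R2_pos hM x).ne'
    | exact (R2_pos hM x).ne')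

/-- The Lagrangian profile actually used, `gwLag = mzProfileW − b`, is smooth. [folklore] -/
theorem contDiff_gwLag (hM : M ≠ 0) : ContDiff ℝ ∞ (gwLag M) :=
  (contDiff_mzProfileW_gw hM).sub (contDiff_gwBump hM)

/-- `(gwLag)' = mzProfileW' − b'`. [folklore] -/
theorem deriv_gwLag (hM : M ≠ 0) :
    deriv (gwLag M) = fun r ↦ mzProfileW' M (gwSeed M) (gwSeed₁ M) (gwSeed₂ M) r - gwBump₁ M r := by
  funext r
  have h₁ := hasDerivAt_mzProfileW hM (hasDerivAt_gwSeed hM r) (hasDerivAt_gwSeed₁ hM r)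
  have h₂ := hasDerivAt_gwBump hM r
  exact (h₁.sub h₂).deriv

/-- `(gwLag)'' = (mzProfileW')' − b''`. [folklore] -/
theorem deriv_deriv_gwLag (hM : M ≠ 0) (r : ℝ) :
    deriv (deriv (gwLag M)) r =
      deriv (mzProfileW' M (gwSeed M) (gwSeed₁ M) (gwSeed₂ M)) r - gwBump₂ M r := by
  rw [deriv_gwLag hM]
  have h₁ : DifferentiableAt ℝ (mzProfileW' M (gwSeed M) (gwSeed₁ M) (gwSeed₂ M)) r :=
    ((contDiff_mzProfileW'_gw hM).differentiable (by simp)).differentiableAt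
  have h₂ := hasDerivAt_gwBump₁ hM r
  have h := h₁.hasDerivAt.sub h₂
  exact h.deriv

/-- `(mzProfileW)'' = (mzProfileW')'` for the seed. [folklore] -/
theorem deriv_deriv_mzProfileW_gw (hM : M ≠ 0) (r : ℝ) :
    deriv (deriv (mzProfileW M (gwSeed M) (gwSeed₁ M))) r =
      deriv (mzProfileW' M (gwSeed M) (gwSeed₁ M) (gwSeed₂ M)) r := by
  rw [deriv_mzProfileW hM (hasDerivAt_gwSeed hM) (hasDerivAt_gwSeed₁ hM)]

end Smoothness

/-! ### The Hardy one-form `J = ¼ψ² v ∂_r^{BL}` in divergence form -/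

section HardyCurrent

variable (M : ℝ)

/-- The `t*`-density of the one-form current `¼ψ²(Δṽ)∂_r^{BL}`: `½ M r Σ sin θ ṽ G²`
(`∂_r^{BL} = ∂_r + (2Mr/Δ)∂_{t*}`, `Σ = r² + M²cos²θ`). [cite: GiorgiWan2024, Lemma 3.2 and §4.2] -/
def jDensity (v : ℝ → ℝ) (G : E4 → ℝ) : E4 → ℝ := fun q ↦
  1 / 2 * M * q 1 * (q 1 ^ 2 + M ^ 2 * cos (q 2) ^ 2) * sin (q 2) * v (q 1) * G q ^ 2

/-- The radial flux of `¼ψ²(Δṽ)∂_r^{BL}`: `¼ Σ Δ sin θ ṽ G²` (vanishing on `{r = M}`).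
[cite: GiorgiWan2024, Lemma 3.2 and §4.2] -/
def jFluxR (v : ℝ → ℝ) (G : E4 → ℝ) : E4 → ℝ := fun q ↦
  1 / 4 * (q 1 ^ 2 + M ^ 2 * cos (q 2) ^ 2) * (q 1 - M) ^ 2 * sin (q 2) * v (q 1) * G q ^ 2

/-- The divergence of `¼ψ²(Δṽ)∂_r^{BL}` (times `ρ² sin θ`):
`sin θ [½ Σ ṽ G (Δ∂_rG + 2Mr∂_{t*}G) + ¼(Σ(2(r − M)ṽ + Δṽ') + 2rΔṽ) G²]` — the terms
`¼|q|²(2vψ∂_rψ + (∂_r v + 2rv/|q|²)ψ²)` of Giorgi–Wan, Lemma 3.2, with `v = Δṽ`.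
[cite: GiorgiWan2024, Lemma 3.2] -/
def jBulk (v v₁ : ℝ → ℝ) (G : E4 → ℝ) : E4 → ℝ := fun q ↦
  sin (q 2) * (1 / 2 * (q 1 ^ 2 + M ^ 2 * cos (q 2) ^ 2) * v (q 1) * G q *
      ((q 1 - M) ^ 2 * pd 1 G q + 2 * M * q 1 * pd 0 G q) +
    1 / 4 * ((q 1 ^ 2 + M ^ 2 * cos (q 2) ^ 2) * (2 * (q 1 - M) * v (q 1) + (q 1 - M) ^ 2 * v₁ (q 1)) +
      2 * q 1 * ((q 1 - M) ^ 2 * v (q 1))) * G q ^ 2)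

variable {M}

/-- The radial flux of the Hardy current vanishes on the extremal horizon `{r = M}`. [cite: GiorgiWan2024, §4.2] -/
theorem jFluxR_horizon (v : ℝ → ℝ) (G : E4 → ℝ) {q : E4} (hq : q 1 = M) : jFluxR M v G q = 0 := by
  simp [jFluxR, hq]

variable {W : Set E4} (hW : IsOpen W)
include hW

/-- **The Hardy current is a divergence (pointwise)**: for `G` smooth on an open `W` and `ṽ`
differentiable with derivative `ṽ₁`, `∂_{t*} jDensity + ∂_r jFluxR = jBulk` on `W` — the identity
`∇^μ(¼ψ²J_μ) = ½ψ J(ψ) + ¼ψ² div J` of Giorgi–Wan, Lemma 3.2, for `J = (Δṽ)∂_r^{BL}` in the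
coordinates `(t*, r, θ, φ*)` (product rule only; no equation is used). [cite: GiorgiWan2024, Lemma 3.2] -/
theorem j_identity {v v₁ : ℝ → ℝ} (hv : ∀ r, HasDerivAt v (v₁ r) r) {G : E4 → ℝ}
    (hG : ContDiffOn ℝ ∞ G W) :
    EqOn (fun q ↦ pd 0 (jDensity M v G) q + pd 1 (jFluxR M v G) q) (jBulk M v v₁ G) W := by
  intro q hq
  -- derivatives of the coefficient functions
  have dr : HasFDerivAt (fun q : E4 ↦ q 1) ((1 : ℝ) • PiLp.proj (𝕜 := ℝ) 2 (fun _ : Fin 4 ↦ ℝ) 1) q :=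
    hasFDerivAt_coefFun (f := fun r ↦ r) (hasDerivAt_id' (q 1))
  have dΔ : HasFDerivAt (fun q : E4 ↦ (q 1 - M) ^ 2)
      ((2 * (q 1 - M)) • PiLp.proj (𝕜 := ℝ) 2 (fun _ : Fin 4 ↦ ℝ) 1) q := by
    refine hasFDerivAt_coefFun (f := fun r ↦ (r - M) ^ 2) ?_
    have h := ((hasDerivAt_id' (q 1)).sub_const M).fun_pow 2
    exact h.congr_deriv (by push_cast; ring)
  have dSig : HasFDerivAt (fun q : E4 ↦ q 1 ^ 2 + M ^ 2 * cos (q 2) ^ 2)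
      ((2 * q 1) • PiLp.proj (𝕜 := ℝ) 2 (fun _ : Fin 4 ↦ ℝ) 1 +
        (M ^ 2 * (2 * cos (q 2) * -sin (q 2))) • PiLp.proj (𝕜 := ℝ) 2 (fun _ : Fin 4 ↦ ℝ) 2) q := by
    have hA : HasFDerivAt (fun q : E4 ↦ q 1 ^ 2)
        ((2 * q 1) • PiLp.proj (𝕜 := ℝ) 2 (fun _ : Fin 4 ↦ ℝ) 1) q := by
      refine hasFDerivAt_coefFun (f := fun r ↦ r ^ 2) ?_
      exact ((hasDerivAt_id' (q 1)).fun_pow 2).congr_deriv (by push_cast; ring)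
    have hB : HasFDerivAt (fun q : E4 ↦ M ^ 2 * cos (q 2) ^ 2)
        ((M ^ 2 * (2 * cos (q 2) * -sin (q 2))) • PiLp.proj (𝕜 := ℝ) 2 (fun _ : Fin 4 ↦ ℝ) 2) q := by
      refine hasFDerivAt_coefFun (f := fun θ ↦ M ^ 2 * cos θ ^ 2) ?_
      exact (((hasDerivAt_cos (q 2)).pow 2).const_mul (M ^ 2)).congr_deriv (by push_cast; ring)
    exact hA.add hB
  have dsin : HasFDerivAt (fun q : E4 ↦ sin (q 2))
      ((cos (q 2)) • PiLp.proj (𝕜 := ℝ) 2 (fun _ : Fin 4 ↦ ℝ) 2) q :=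
    hasFDerivAt_coefFun (f := fun θ ↦ sin θ) (hasDerivAt_sin (q 2))
  have dv : HasFDerivAt (fun q : E4 ↦ v (q 1)) ((v₁ (q 1)) • PiLp.proj (𝕜 := ℝ) 2 (fun _ : Fin 4 ↦ ℝ) 1) q :=
    hasFDerivAt_coefFun (f := v) (hv (q 1))
  -- `G` at `q`
  have DG := hasFDerivAt_of_contDiffOn hW hG hq
  -- the two densities
  have hE : HasFDerivAt (jDensity M v G) _ q :=
    (((((dr.const_mul (1 / 2 * M)).mul dSig).mul dsin).mul dv).mul (DG.pow 2))
  have hF : HasFDerivAt (jFluxR M v G) _ q :=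
    (((((dSig.const_mul (1 / 4 : ℝ)).mul dΔ).mul dsin).mul dv).mul (DG.pow 2))
  -- evaluation of the coordinate projections on the basis vectors
  have p11 : (PiLp.proj (𝕜 := ℝ) 2 (fun _ : Fin 4 ↦ ℝ) 1) (E4.basisVector 1) = 1 := by
    rw [proj_basisVector, if_pos rfl]
  have p12 : (PiLp.proj (𝕜 := ℝ) 2 (fun _ : Fin 4 ↦ ℝ) 2) (E4.basisVector 1) = 0 := by
    rw [proj_basisVector, if_neg (by decide)]
  have p01 : (PiLp.proj (𝕜 := ℝ) 2 (fun _ : Fin 4 ↦ ℝ) 1) (E4.basisVector 0) = 0 := by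
    rw [proj_basisVector, if_neg (by decide)]
  have p02 : (PiLp.proj (𝕜 := ℝ) 2 (fun _ : Fin 4 ↦ ℝ) 2) (E4.basisVector 0) = 0 := by
    rw [proj_basisVector, if_neg (by decide)]
  beta_reduce
  rw [pd_apply (G := jDensity M v G), hE.fderiv, pd_apply (G := jFluxR M v G), hF.fderiv]
  simp only [FunLike.coe_add, Pi.add_apply, FunLike.coe_smul,
    Pi.smul_apply, smul_eq_mul, nsmul_eq_mul, Pi.mul_apply, p11, p12, p01, p02,
    Nat.cast_ofNat, Nat.add_one_sub_one, pow_one, mul_one, mul_zero, add_zero, zero_add]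
  simp only [← pd_apply]
  simp only [jBulk]
  ring

omit hW in
/-- Smoothness of the Hardy densities on an open set of smoothness of `G`, for smooth `ṽ`, and
continuity of the bulk. [folklore] -/
theorem contDiffOn_j (hW : IsOpen W) {G : E4 → ℝ} (hG : ContDiffOn ℝ ∞ G W) {v v₁ : ℝ → ℝ}
    (hv : ContDiff ℝ ∞ v) (hv₁ : ContDiff ℝ ∞ v₁) :
    ContDiffOn ℝ ∞ (jDensity M v G) W ∧ ContDiffOn ℝ ∞ (jFluxR M v G) W ∧
      ContinuousOn (jBulk M v v₁ G) W := by
  have h0 := contDiffOn_pd hW hG 0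
  have h1 := contDiffOn_pd hW hG 1
  have cr : ContDiffOn ℝ ∞ (fun q : E4 ↦ q 1) W := (contDiff_coord 1).contDiffOn
  have cθ : ContDiffOn ℝ ∞ (fun q : E4 ↦ q 2) W := (contDiff_coord 2).contDiffOn
  have csin : ContDiffOn ℝ ∞ (fun q : E4 ↦ sin (q 2)) W := contDiff_sin.comp_contDiffOn cθ
  have ccos : ContDiffOn ℝ ∞ (fun q : E4 ↦ cos (q 2)) W := contDiff_cos.comp_contDiffOn cθ
  have cv : ContDiffOn ℝ ∞ (fun q : E4 ↦ v (q 1)) W := hv.comp_contDiffOn cr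
  have cv₁ : ContDiffOn ℝ ∞ (fun q : E4 ↦ v₁ (q 1)) W := hv₁.comp_contDiffOn cr
  have cc : ∀ c : ℝ, ContDiffOn ℝ ∞ (fun _ : E4 ↦ c) W := fun c ↦ contDiffOn_const
  have cSig : ContDiffOn ℝ ∞ (fun q : E4 ↦ q 1 ^ 2 + M ^ 2 * cos (q 2) ^ 2) W :=
    (cr.pow 2).add ((cc (M ^ 2)).mul (ccos.pow 2))
  have cΔ : ContDiffOn ℝ ∞ (fun q : E4 ↦ (q 1 - M) ^ 2) W := (cr.sub (cc M)).pow 2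
  refine ⟨?_, ?_, ?_⟩
  · unfold jDensity
    exact ((((((cc (1 / 2)).mul (cc M)).mul cr).mul cSig).mul csin).mul cv).mul (hG.pow 2)
  · unfold jFluxR
    exact (((((cc (1 / 4)).mul cSig).mul cΔ).mul csin).mul cv).mul (hG.pow 2)
  · unfold jBulk
    have hX : ContDiffOn ℝ ∞ (fun q : E4 ↦ (q 1 - M) ^ 2 * pd 1 G q + 2 * M * q 1 * pd 0 G q) W :=
      (cΔ.mul h1).add ((((cc 2).mul (cc M)).mul cr).mul h0)
    have hA : ContDiffOn ℝ ∞ (fun q : E4 ↦ 1 / 2 * (q 1 ^ 2 + M ^ 2 * cos (q 2) ^ 2) * v (q 1) * G q *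
        ((q 1 - M) ^ 2 * pd 1 G q + 2 * M * q 1 * pd 0 G q)) W :=
      ((((cc (1 / 2)).mul cSig).mul cv).mul hG).mul hX
    have hB : ContDiffOn ℝ ∞ (fun q : E4 ↦ 1 / 4 * ((q 1 ^ 2 + M ^ 2 * cos (q 2) ^ 2) *
        (2 * (q 1 - M) * v (q 1) + (q 1 - M) ^ 2 * v₁ (q 1)) + 2 * q 1 * ((q 1 - M) ^ 2 * v (q 1))) *
        G q ^ 2) W :=
      ((cc (1 / 4)).mul ((cSig.mul (((((cc 2).mul (cr.sub (cc M))).mul cv)).add (cΔ.mul cv₁))).add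
        (((cc 2).mul cr).mul (cΔ.mul cv)))).mul (hG.pow 2)
    exact (csin.mul (hA.add hB)).continuousOn

omit hW in
/-- **The Hardy current on a coordinate box**: for `G` smooth on an open `W₀` containing
`[t₁, t₂] × [r₁, r₂] × [0, π]` (at `φ₀`) and smooth `ṽ` (`ṽ' = ṽ₁`),
`∫∫ jDensity(t₂) − ∫∫ jDensity(t₁) − ∫_{t₁}^{t₂}∫∫ jBulk = −∫_{t₁}^{t₂}∫₀^π (jFluxR(t, r₂, θ) − jFluxR(t, r₁, θ)) dθ dt`
(`box_divergence_identity` for the divergence `j_identity`; no polar flux). [cite: GiorgiWan2024, §3.2 and Lemma 3.2] -/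
theorem j_box_identity {W₀ : Set E4} (hW₀ : IsOpen W₀) {G : E4 → ℝ} (hG : ContDiffOn ℝ ∞ G W₀)
    {v v₁ : ℝ → ℝ} (hv : ContDiff ℝ ∞ v) (hv₁ : ContDiff ℝ ∞ v₁) (hvd : ∀ r, HasDerivAt v (v₁ r) r)
    {t₁ t₂ r₁ r₂ φ₀ : ℝ} (ht : t₁ ≤ t₂) (hr : r₁ ≤ r₂)
    (hbox : ∀ t ∈ Icc t₁ t₂, ∀ r ∈ Icc r₁ r₂, ∀ θ ∈ Icc 0 π, boxPoint φ₀ t r θ ∈ W₀) :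
    (∫ θ in (0 : ℝ)..π, ∫ r in r₁..r₂, jDensity M v G (boxPoint φ₀ t₂ r θ)) -
        (∫ θ in (0 : ℝ)..π, ∫ r in r₁..r₂, jDensity M v G (boxPoint φ₀ t₁ r θ)) -
        (∫ t in t₁..t₂, ∫ θ in (0 : ℝ)..π, ∫ r in r₁..r₂, jBulk M v v₁ G (boxPoint φ₀ t r θ)) =
      -∫ t in t₁..t₂, ∫ θ in (0 : ℝ)..π,
          (jFluxR M v G (boxPoint φ₀ t r₂ θ) - jFluxR M v G (boxPoint φ₀ t r₁ θ)) := by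
  obtain ⟨cD, cFl, cB⟩ := contDiffOn_j (M := M) hW₀ hG hv hv₁
  have hid := j_identity (M := M) hW₀ hvd hG
  have hid' : ∀ q ∈ W₀, pd 0 (jDensity M v G) q + (-jBulk M v v₁ G) q =
      pd 1 (-jFluxR M v G) q + pd 2 (fun _ : E4 ↦ (0 : ℝ)) q := by
    intro q hq
    have h := hid hq
    simp only at h
    have h2 : pd 2 (fun _ : E4 ↦ (0 : ℝ)) q = 0 := by simp [pd_apply]
    rw [pd_neg, h2, Pi.neg_apply]
    linarith
  have hbox' := box_divergence_identity hW₀ cD cFl.neg contDiffOn_const cB.neg hid' ht hr hbox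
  have hfl : (∫ t in t₁..t₂, ∫ θ in (0 : ℝ)..π,
      (-jFluxR M v G (boxPoint φ₀ t r₂ θ) - -jFluxR M v G (boxPoint φ₀ t r₁ θ))) =
      -∫ t in t₁..t₂, ∫ θ in (0 : ℝ)..π,
        (jFluxR M v G (boxPoint φ₀ t r₂ θ) - jFluxR M v G (boxPoint φ₀ t r₁ θ)) := by
    rw [← intervalIntegral.integral_neg]
    refine intervalIntegral.integral_congr fun t _ ↦ ?_
    rw [← intervalIntegral.integral_neg]
    refine intervalIntegral.integral_congr fun θ _ ↦ ?_
    ring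
  have hθ0 : (∫ t in t₁..t₂, ∫ r in r₁..r₂, ((0 : ℝ) - 0)) = 0 := by simp
  rw [hfl, hθ0, add_zero] at hbox'
  have hB : (∫ t in t₁..t₂, ∫ θ in (0 : ℝ)..π, ∫ r in r₁..r₂, (-jBulk M v v₁ G) (boxPoint φ₀ t r θ)) =
      -∫ t in t₁..t₂, ∫ θ in (0 : ℝ)..π, ∫ r in r₁..r₂, jBulk M v v₁ G (boxPoint φ₀ t r θ) := by
    simp only [Pi.neg_apply, intervalIntegral.integral_neg]
  rw [hB] at hbox'
  linarith

end HardyCurrent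

/-! ### The total bulk as an explicit quadratic form -/

section Decomposition

variable (M : ℝ)

/-- The first-square coefficient `f'/R2 = 2M(r² + 2Mr − M²)/(r² + M²)³` of the seed.
[cite: GiorgiWan2024, §4.1] -/
def gwF (r : ℝ) : ℝ := (-2 * M ^ 3 + 4 * M ^ 2 * r + 2 * M * r ^ 2) / (r ^ 2 + M ^ 2) ^ 3

/-- The angular coefficient `A = (r − M)(r² − 2Mr − M²)²/(r² + M²)³` of the seed (`= f·𝒯/R2²`,
`𝒯 = (r − M)(r² − 2Mr − M²)` the trapping polynomial of extremal Kerr in axisymmetry).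
[cite: GiorgiWan2024, §2.3 and §4.1] -/
def gwAng (r : ℝ) : ℝ := (r - M) * (r ^ 2 - 2 * M * r - M ^ 2) ^ 2 / (r ^ 2 + M ^ 2) ^ 3

/-- The zeroth-order coefficient `C_f = 4M(M⁶ + 2M⁵r − 11M⁴r² + 10M³r³ + M²r⁴ − 4Mr⁵ + r⁶)/(r² + M²)⁴`
of the seed (`= −½(Δ w')'`, `w = (r − M)³/(r² + M²)²`; of both signs). [cite: GiorgiWan2024, §4.1] -/
def gwCf (r : ℝ) : ℝ :=
  (4 * M ^ 7 + 8 * M ^ 6 * r - 44 * M ^ 5 * r ^ 2 + 40 * M ^ 4 * r ^ 3 + 4 * M ^ 3 * r ^ 4 -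
    16 * M ^ 2 * r ^ 5 + 4 * M * r ^ 6) / (r ^ 2 + M ^ 2) ^ 4

/-- **The total bulk quadratic form** in `(G, G₀, G₁, G₂) = (G, ∂_{t*}G, ∂_rG, ∂_θG)` at radius `r`
and `c = cos θ`: Morawetz part (first square, angular term, zeroth order), the bulk of the bump `−b`,
and the Hardy divergence `jBulk` (all divided by `sin θ`). [cite: GiorgiWan2024, Lemma 3.2 and §4] -/
def gwQuad (r c G G₀ G₁ G₂ : ℝ) : ℝ :=
  gwF M r * ((r - M) ^ 2 * G₁ + 2 * M * r * G₀) ^ 2 +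
    gwAng M r * (G₂ ^ 2 + M ^ 2 * (1 - c ^ 2) * G₀ ^ 2) + gwCf M r * G ^ 2 +
    (-(gwBump M r * (r - M) ^ 2 * G₁ ^ 2) +
      1 / 2 * (gwBump₂ M r * (r - M) ^ 2 + gwBump₁ M r * (2 * r - 2 * M)) * G ^ 2 -
      4 * M * r * gwBump M r * G₀ * G₁ + (r ^ 2 + M ^ 2 * c ^ 2 + 2 * M * r) * gwBump M r * G₀ ^ 2 -
      gwBump M r * G₂ ^ 2) +
    (1 / 2 * (r ^ 2 + M ^ 2 * c ^ 2) * gwJ M r * G * ((r - M) ^ 2 * G₁ + 2 * M * r * G₀) +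
      1 / 4 * ((r ^ 2 + M ^ 2 * c ^ 2) * (2 * (r - M) * gwJ M r + (r - M) ^ 2 * gwJ₁ M r) +
        2 * r * ((r - M) ^ 2 * gwJ M r)) * G ^ 2)

variable {M}

/-- The angular coefficient of the seed in closed form. [cite: GiorgiWan2024, §4.1] -/
theorem mzAngCoeff_gwSeed (hM : M ≠ 0) (r : ℝ) : mzAngCoeff M (gwSeed M) r = gwAng M r := by
  have hR := (R2_pos hM r).ne'
  simp only [mzAngCoeff, gwSeed, gwAng]
  field_simp

/-- The zeroth-order coefficient of the seed in closed form. [cite: GiorgiWan2024, §4.1] -/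
theorem mzZeroCoeff_gwSeed (hM : M ≠ 0) (r : ℝ) :
    mzZeroCoeff M (gwSeed M) (gwSeed₁ M) (gwSeed₂ M) (gwSeed₃ M) r = gwCf M r := by
  have hR := (R2_pos hM r).ne'
  simp only [mzZeroCoeff, gwSeed, gwSeed₁, gwSeed₂, gwSeed₃, gwCf]
  field_simp
  ring

/-- The first-square coefficient of the seed in closed form. [cite: GiorgiWan2024, §4.1] -/
theorem gwSeed₁_div_R2 (hM : M ≠ 0) (r : ℝ) : gwSeed₁ M r / (r ^ 2 + M ^ 2) = gwF M r := by
  have hR := (R2_pos hM r).ne'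
  simp only [gwSeed₁, gwF]
  field_simp

/-- The Lagrangian profile of the seed in closed form: `mzProfileW = (r − M)³/(r² + M²)²`.
[cite: GiorgiWan2024, §4.1] -/
theorem mzProfileW_gwSeed (hM : M ≠ 0) (r : ℝ) :
    mzProfileW M (gwSeed M) (gwSeed₁ M) r = (r - M) ^ 3 / (r ^ 2 + M ^ 2) ^ 2 := by
  have hR := (R2_pos hM r).ne'
  simp only [mzProfileW, gwSeed, gwSeed₁]
  field_simp
  ring

/-- **Splitting off the bump**: the bulk of `(f̃, h̃, mzProfileW − b)` is the bulk of
`(f̃, h̃, mzProfileW)` minus the Lagrangian bulk of `b` (linearity in the Lagrangian profile).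
[cite: GiorgiWan2024, Lemma 3.2] -/
theorem multBulk_gwLag (hM : M ≠ 0) (G : E4 → ℝ) (q : E4) :
    multBulk M M (mzProfileR M (gwSeed M)) (mzProfileT M (gwSeed M)) (gwLag M) G q =
      multBulk M M (mzProfileR M (gwSeed M)) (mzProfileT M (gwSeed M))
          (mzProfileW M (gwSeed M) (gwSeed₁ M)) G q -
        lagBulk M M (gwBump M) (gwBump₁ M) (gwBump₂ M) G q := by
  simp only [multBulk, lagBulk]
  rw [deriv_deriv_gwLag hM (q 1), deriv_deriv_mzProfileW_gw hM (q 1), deriv_gwLag hM,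
    deriv_mzProfileW hM (hasDerivAt_gwSeed hM) (hasDerivAt_gwSeed₁ hM)]
  simp only [gwLag]
  ring

/-- **The total bulk is `sin θ · gwQuad`**: for every `G` and every point `q` (`M ≠ 0`),
`−multBulk(f̃, h̃, mzProfileW − b) + jBulk(ṽ) = sin θ · gwQuad(r, cos θ, G, ∂_{t*}G, ∂_rG, ∂_θG)`.
[cite: GiorgiWan2024, Lemma 3.2 and §4] -/
theorem gwGood_eq (hM : M ≠ 0) (G : E4 → ℝ) (q : E4) :
    -multBulk M M (mzProfileR M (gwSeed M)) (mzProfileT M (gwSeed M)) (gwLag M) G q +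
        jBulk M (gwJ M) (gwJ₁ M) G q =
      sin (q 2) * gwQuad M (q 1) (cos (q 2)) (G q) (pd 0 G q) (pd 1 G q) (pd 2 G q) := by
  have hf : ∀ᶠ x in 𝓝 (q 1), HasDerivAt (gwSeed M) (gwSeed₁ M x) x :=
    Filter.Eventually.of_forall (hasDerivAt_gwSeed hM)
  have hf₁ : ∀ᶠ x in 𝓝 (q 1), HasDerivAt (gwSeed₁ M) (gwSeed₂ M x) x :=
    Filter.Eventually.of_forall (hasDerivAt_gwSeed₁ hM)
  have hf₂ : HasDerivAt (gwSeed₂ M) (gwSeed₃ M (q 1)) (q 1) := hasDerivAt_gwSeed₂ hM (q 1)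
  rw [multBulk_gwLag hM, neg_sub', sub_neg_eq_add, neg_multBulk_morawetz hM hf hf₁ hf₂,
    mzAngCoeff_gwSeed hM, mzZeroCoeff_gwSeed hM, gwSeed₁_div_R2 hM]
  simp only [lagBulk, jBulk, gwQuad]
  ring

end Decomposition

/-! ### Positivity: the certificates -/

section Positivity

variable (M : ℝ)

/-- The bump over `Δ`: `β = (M/20)(r² − 2Mr − M²)²/(r² + M²)⁴` (`b = Δβ`). [cite: GiorgiWan2024, §4.2] -/
def gwBeta (r : ℝ) : ℝ := M / 20 * (r ^ 2 - 2 * M * r - M ^ 2) ^ 2 / (r ^ 2 + M ^ 2) ^ 4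

/-- The `X²`-coefficient `α = (9/10) f'/R2 − β` of the `(X, G)`-block. [cite: GiorgiWan2024, §4.2] -/
def gwAlpha (r : ℝ) : ℝ := 9 / 10 * gwF M r - gwBeta M r

/-- The `XG`-coefficient `κ = ½Σṽ` of the `(X, G)`-block (`Σ = r² + M²c²`). [cite: GiorgiWan2024, §4.2] -/
def gwKappa (r c : ℝ) : ℝ := 1 / 2 * (r ^ 2 + M ^ 2 * c ^ 2) * gwJ M r

/-- The `G²`-coefficient `γ = C_f + ½(Δb')' + ¼(Σ(Δṽ)' + 2rΔṽ)` of the `(X, G)`-block.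
[cite: GiorgiWan2024, §4.2] -/
def gwGamma (r c : ℝ) : ℝ :=
  gwCf M r + 1 / 2 * (gwBump₂ M r * (r - M) ^ 2 + gwBump₁ M r * (2 * r - 2 * M)) +
    1 / 4 * ((r ^ 2 + M ^ 2 * c ^ 2) * (2 * (r - M) * gwJ M r + (r - M) ^ 2 * gwJ₁ M r) +
      2 * r * ((r - M) ^ 2 * gwJ M r))

/-- Numerator of `α` over `(r² + M²)⁴`. [cite: GiorgiWan2024, §4.2] -/
def gwAlphaN (r : ℝ) : ℝ :=
  -(37 / 20) * M ^ 5 + 17 / 5 * M ^ 4 * r - 1 / 10 * M ^ 3 * r ^ 2 + 19 / 5 * M ^ 2 * r ^ 3 +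
    7 / 4 * M * r ^ 4

/-- The `Σ`-free part of the numerator of `γ` over `(r² + M²)⁶`. [cite: GiorgiWan2024, §4.2] -/
def gwGamma0N (r : ℝ) : ℝ :=
  69 / 20 * M ^ 11 + 81 / 10 * M ^ 10 * r - 459 / 20 * M ^ 9 * r ^ 2 + 317 / 10 * M ^ 8 * r ^ 3 -
    407 / 5 * M ^ 7 * r ^ 4 + 947 / 10 * M ^ 6 * r ^ 5 - 139 / 5 * M ^ 5 * r ^ 6 - 41 / 2 * M ^ 4 * r ^ 7 +
    139 / 4 * M ^ 3 * r ^ 8 - 138 / 5 * M ^ 2 * r ^ 9 + 151 / 20 * M * r ^ 10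

/-- The `Σ`-coefficient of the numerator of `γ` over `(r² + M²)⁵`. [cite: GiorgiWan2024, §4.2] -/
def gwGamma1N (r : ℝ) : ℝ :=
  -(7 / 2) * M ^ 6 * r + 63 / 4 * M ^ 5 * r ^ 2 - 21 / 2 * M ^ 4 * r ^ 3 - 35 / 2 * M ^ 3 * r ^ 4 +
    21 * M ^ 2 * r ^ 5 - 21 / 4 * M * r ^ 6

/-- The numerator of the discriminant `4αγ − κ²` over `(r² + M²)¹⁰`, as a function of `Σ`.
[cite: GiorgiWan2024, §4.2] -/
def gwCertN (r Sig : ℝ) : ℝ :=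
  4 * gwAlphaN M r * (gwGamma0N M r + Sig * gwGamma1N M r * (r ^ 2 + M ^ 2)) -
    (7 / 2 * M * Sig * (r ^ 2 * (r - M))) ^ 2 * (r ^ 2 + M ^ 2) ^ 2

/-- **The low certificate** (`Σ = r²`): the numerator of `4αγ − κ²` is a combination of
`(r − M)^k M^{16−k}`, `2 ≤ k ≤ 14`, with NON-NEGATIVE rational coefficients. [cite: GiorgiWan2024, §4.2] -/
def gwCertLow (r : ℝ) : ℝ :=
  3031 / 5 * M ^ 14 * (r - M) ^ 2 + 55934 / 25 * M ^ 13 * (r - M) ^ 3 + 74294 / 25 * M ^ 12 * (r - M) ^ 4 +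
    79323 / 25 * M ^ 11 * (r - M) ^ 5 + 134891 / 20 * M ^ 10 * (r - M) ^ 6 + 64008 / 5 * M ^ 9 * (r - M) ^ 7 +
    75276 / 5 * M ^ 8 * (r - M) ^ 8 + 283447 / 25 * M ^ 7 * (r - M) ^ 9 + 572421 / 100 * M ^ 6 * (r - M) ^ 10 +
    49578 / 25 * M ^ 5 * (r - M) ^ 11 + 23437 / 50 * M ^ 4 * (r - M) ^ 12 + 1679 / 25 * M ^ 3 * (r - M) ^ 13 +
    77 / 20 * M ^ 2 * (r - M) ^ 14

/-- **The high certificate** (`Σ = r² + M²`): likewise with non-negative coefficients.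
[cite: GiorgiWan2024, §4.2] -/
def gwCertHigh (r : ℝ) : ℝ :=
  5236 / 5 * M ^ 14 * (r - M) ^ 2 + 123344 / 25 * M ^ 13 * (r - M) ^ 3 + 234524 / 25 * M ^ 12 * (r - M) ^ 4 +
    250648 / 25 * M ^ 11 * (r - M) ^ 5 + 38138 / 5 * M ^ 10 * (r - M) ^ 6 + 29988 / 5 * M ^ 9 * (r - M) ^ 7 +
    28236 / 5 * M ^ 8 * (r - M) ^ 8 + 119682 / 25 * M ^ 7 * (r - M) ^ 9 + 303621 / 100 * M ^ 6 * (r - M) ^ 10 +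
    34108 / 25 * M ^ 5 * (r - M) ^ 11 + 40749 / 100 * M ^ 4 * (r - M) ^ 12 + 1679 / 25 * M ^ 3 * (r - M) ^ 13 +
    77 / 20 * M ^ 2 * (r - M) ^ 14

variable {M}

/-- The low certificate is an identity. [cite: GiorgiWan2024, §4.2] -/
theorem gwCertN_low (M r : ℝ) : gwCertN M r (r ^ 2) = gwCertLow M r := by
  simp only [gwCertN, gwCertLow, gwAlphaN, gwGamma0N, gwGamma1N]
  ring

/-- The high certificate is an identity. [cite: GiorgiWan2024, §4.2] -/
theorem gwCertN_high (M r : ℝ) : gwCertN M r (r ^ 2 + M ^ 2) = gwCertHigh M r := by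
  simp only [gwCertN, gwCertHigh, gwAlphaN, gwGamma0N, gwGamma1N]
  ring

/-- **Concavity in `Σ`**: the discriminant numerator at `Σ` is the linear interpolation of its
values at `Σ = r²` and `Σ = r² + M²` plus a non-negative correction. [cite: GiorgiWan2024, §4.2] -/
theorem gwCertN_interp (M r Sig : ℝ) :
    M ^ 2 * gwCertN M r Sig = (r ^ 2 + M ^ 2 - Sig) * gwCertN M r (r ^ 2) + (Sig - r ^ 2) * gwCertN M r (r ^ 2 + M ^ 2) +
      49 / 4 * M ^ 4 * r ^ 4 * (r - M) ^ 2 * (r ^ 2 + M ^ 2) ^ 2 * (Sig - r ^ 2) * (r ^ 2 + M ^ 2 - Sig) := by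
  simp only [gwCertN]
  ring

/-- The low certificate is non-negative on `r ≥ M`. [cite: GiorgiWan2024, §4.2] -/
theorem gwCertLow_nonneg (hM : 0 ≤ M) {r : ℝ} (hr : M ≤ r) : 0 ≤ gwCertLow M r := by
  have hx : 0 ≤ r - M := sub_nonneg.mpr hr
  unfold gwCertLow
  positivity

/-- The high certificate is non-negative on `r ≥ M`. [cite: GiorgiWan2024, §4.2] -/
theorem gwCertHigh_nonneg (hM : 0 ≤ M) {r : ℝ} (hr : M ≤ r) : 0 ≤ gwCertHigh M r := by
  have hx : 0 ≤ r - M := sub_nonneg.mpr hr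
  unfold gwCertHigh
  positivity

/-- The discriminant numerator is non-negative for `r ≥ M` and `r² ≤ Σ ≤ r² + M²`. [cite: GiorgiWan2024, §4.2] -/
theorem gwCertN_nonneg (hM : 0 < M) {r Sig : ℝ} (hr : M ≤ r) (h₁ : r ^ 2 ≤ Sig) (h₂ : Sig ≤ r ^ 2 + M ^ 2) :
    0 ≤ gwCertN M r Sig := by
  have h := gwCertN_interp M r Sig
  rw [gwCertN_low, gwCertN_high] at h
  have hA : 0 ≤ (r ^ 2 + M ^ 2 - Sig) * gwCertLow M r :=
    mul_nonneg (sub_nonneg.mpr h₂) (gwCertLow_nonneg hM.le hr)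
  have hB : 0 ≤ (Sig - r ^ 2) * gwCertHigh M r :=
    mul_nonneg (sub_nonneg.mpr h₁) (gwCertHigh_nonneg hM.le hr)
  have hC : 0 ≤ 49 / 4 * M ^ 4 * r ^ 4 * (r - M) ^ 2 * (r ^ 2 + M ^ 2) ^ 2 * (Sig - r ^ 2) * (r ^ 2 + M ^ 2 - Sig) := by
    have := sub_nonneg.mpr h₁
    have := sub_nonneg.mpr h₂
    positivity
  have hM2 : 0 < M ^ 2 := by positivity
  nlinarith

/-- `α = αN/(r² + M²)⁴`. [cite: GiorgiWan2024, §4.2] -/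
theorem gwAlpha_eq (hM : M ≠ 0) (r : ℝ) : gwAlpha M r = gwAlphaN M r / (r ^ 2 + M ^ 2) ^ 4 := by
  have hR := (R2_pos hM r).ne'
  simp only [gwAlpha, gwAlphaN, gwF, gwBeta]
  field_simp
  ring

/-- `αN = 7M⁵ + (108/5)M⁴(r−M) + (109/5)M³(r−M)² + (54/5)M²(r−M)³ + (7/4)M(r−M)⁴ > 0` on `r ≥ M`.
[cite: GiorgiWan2024, §4.2] -/
theorem gwAlphaN_pos (hM : 0 < M) {r : ℝ} (hr : M ≤ r) : 0 < gwAlphaN M r := by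
  have hx : 0 ≤ r - M := sub_nonneg.mpr hr
  have h : gwAlphaN M r = 7 * M ^ 5 + 108 / 5 * M ^ 4 * (r - M) + 109 / 5 * M ^ 3 * (r - M) ^ 2 +
      54 / 5 * M ^ 2 * (r - M) ^ 3 + 7 / 4 * M * (r - M) ^ 4 := by
    unfold gwAlphaN; ring
  rw [h]
  positivity

/-- `α > 0` on `r ≥ M`. [cite: GiorgiWan2024, §4.2] -/
theorem gwAlpha_pos (hM : 0 < M) {r : ℝ} (hr : M ≤ r) : 0 < gwAlpha M r := by
  rw [gwAlpha_eq hM.ne' r]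
  exact div_pos (gwAlphaN_pos hM hr) (pow_pos (R2_pos hM.ne' r) _)

/-- `γ = (γ₀N + Σ γ₁N R2)/(r² + M²)⁶`. [cite: GiorgiWan2024, §4.2] -/
theorem gwGamma_eq (hM : M ≠ 0) (r c : ℝ) :
    gwGamma M r c = (gwGamma0N M r + (r ^ 2 + M ^ 2 * c ^ 2) * gwGamma1N M r * (r ^ 2 + M ^ 2)) /
      (r ^ 2 + M ^ 2) ^ 6 := by
  have hR := (R2_pos hM r).ne'
  simp only [gwGamma, gwGamma0N, gwGamma1N, gwCf, gwBump₁, gwBump₂, gwJ, gwJ₁]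
  field_simp
  ring

/-- `κ = (7/2)MΣr²(r−M)/(r² + M²)⁴`. [cite: GiorgiWan2024, §4.2] -/
theorem gwKappa_eq (r c : ℝ) :
    gwKappa M r c = 7 / 2 * M * (r ^ 2 + M ^ 2 * c ^ 2) * (r ^ 2 * (r - M)) / (r ^ 2 + M ^ 2) ^ 4 := by
  simp only [gwKappa, gwJ]
  ring

/-- **The discriminant**: `4αγ − κ² = gwCertN(Σ)/(r² + M²)¹⁰`. [cite: GiorgiWan2024, §4.2] -/
theorem gwDisc_eq (hM : M ≠ 0) (r c : ℝ) :
    4 * gwAlpha M r * gwGamma M r c - gwKappa M r c ^ 2 =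
      gwCertN M r (r ^ 2 + M ^ 2 * c ^ 2) / (r ^ 2 + M ^ 2) ^ 10 := by
  have hR := (R2_pos hM r).ne'
  rw [gwAlpha_eq hM, gwGamma_eq hM, gwKappa_eq]
  simp only [gwCertN]
  field_simp

/-- `4αγ − κ² ≥ 0` for `r ≥ M`, `c² ≤ 1`. [cite: GiorgiWan2024, §4.2] -/
theorem gwDisc_nonneg (hM : 0 < M) {r c : ℝ} (hr : M ≤ r) (hc : c ^ 2 ≤ 1) :
    0 ≤ 4 * gwAlpha M r * gwGamma M r c - gwKappa M r c ^ 2 := by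
  rw [gwDisc_eq hM.ne']
  refine div_nonneg (gwCertN_nonneg hM hr ?_ ?_) (pow_nonneg (R2_pos hM.ne' r).le _)
  · nlinarith [sq_nonneg c, sq_nonneg M]
  · nlinarith [hc, sq_nonneg M]

/-- **The `(X, G)`-block is non-negative**: `αX² + κXG + γG² ≥ (4αγ − κ²)G²/(4α) ≥ 0`
(`4α(αX² + κXG + γG²) = (2αX + κG)² + (4αγ − κ²)G²`, `α > 0`). [cite: GiorgiWan2024, §4.2] -/
theorem gwBlock_ge (hM : 0 < M) {r : ℝ} (c : ℝ) (hr : M ≤ r) (X G : ℝ) :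
    (4 * gwAlpha M r * gwGamma M r c - gwKappa M r c ^ 2) / (4 * gwAlpha M r) * G ^ 2 ≤
      gwAlpha M r * X ^ 2 + gwKappa M r c * X * G + gwGamma M r c * G ^ 2 := by
  have hα := gwAlpha_pos hM hr
  have h4α : 0 < 4 * gwAlpha M r := by positivity
  rw [div_mul_eq_mul_div, div_le_iff₀ h4α]
  nlinarith [sq_nonneg (2 * gwAlpha M r * X + gwKappa M r c * G)]

/-- The `(X, G)`-block is non-negative. [cite: GiorgiWan2024, §4.2] -/
theorem gwBlock_nonneg (hM : 0 < M) {r c : ℝ} (hr : M ≤ r) (hc : c ^ 2 ≤ 1) (X G : ℝ) :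
    0 ≤ gwAlpha M r * X ^ 2 + gwKappa M r c * X * G + gwGamma M r c * G ^ 2 := by
  refine le_trans ?_ (gwBlock_ge hM c hr X G)
  have hα := gwAlpha_pos hM hr
  exact mul_nonneg (div_nonneg (gwDisc_nonneg hM hr hc) (by positivity)) (sq_nonneg _)

/-- **Regrouping of the total form**: `gwQuad = (1/10)(f'/R2)X² + [αX² + κXG + γG²] + (A − b)G_θ²
+ (A M²(1 − c²) + 4M²r²β + (Σ + 2Mr)b)G_t²` (`X = ΔG_r + 2MrG_t`). [cite: GiorgiWan2024, §4.2] -/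
theorem gwQuad_eq_blocks (M r c G G₀ G₁ G₂ : ℝ) :
    gwQuad M r c G G₀ G₁ G₂ =
      1 / 10 * gwF M r * ((r - M) ^ 2 * G₁ + 2 * M * r * G₀) ^ 2 +
        (gwAlpha M r * ((r - M) ^ 2 * G₁ + 2 * M * r * G₀) ^ 2 +
          gwKappa M r c * ((r - M) ^ 2 * G₁ + 2 * M * r * G₀) * G + gwGamma M r c * G ^ 2) +
        (gwAng M r - gwBump M r) * G₂ ^ 2 +
        (gwAng M r * (M ^ 2 * (1 - c ^ 2)) + 4 * M ^ 2 * r ^ 2 * gwBeta M r +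
          (r ^ 2 + M ^ 2 * c ^ 2 + 2 * M * r) * gwBump M r) * G₀ ^ 2 := by
  have hb : gwBump M r = (r - M) ^ 2 * gwBeta M r := by
    simp only [gwBump, gwBeta]; ring
  simp only [gwQuad, gwAlpha, gwKappa, gwGamma, hb]
  ring

/-- `f'/R2 ≥ 0` on `r ≥ M`. [cite: GiorgiWan2024, §4.1] -/
theorem gwF_nonneg (hM : 0 < M) {r : ℝ} (hr : M ≤ r) : 0 ≤ gwF M r := by
  unfold gwF
  refine div_nonneg ?_ (pow_nonneg (R2_pos hM.ne' r).le _)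
  nlinarith [mul_pos hM hM, mul_nonneg hM.le (sub_nonneg.mpr hr)]

/-- `A − b ≥ 0` on `r ≥ M`. [cite: GiorgiWan2024, §4.1–4.2] -/
theorem gwAng_sub_gwBump_nonneg (hM : 0 < M) {r : ℝ} (hr : M ≤ r) : 0 ≤ gwAng M r - gwBump M r := by
  have hR := R2_pos hM.ne' r
  have h : gwAng M r - gwBump M r =
      (r - M) * (r ^ 2 - 2 * M * r - M ^ 2) ^ 2 * (r ^ 2 + M ^ 2 - M / 20 * (r - M)) / (r ^ 2 + M ^ 2) ^ 4 := by
    simp only [gwAng, gwBump]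
    field_simp
  rw [h]
  refine div_nonneg ?_ (pow_nonneg hR.le _)
  have hx : 0 ≤ r - M := sub_nonneg.mpr hr
  have hlast : 0 ≤ r ^ 2 + M ^ 2 - M / 20 * (r - M) := by nlinarith
  positivity

/-- `A ≥ 0` on `r ≥ M`. [cite: GiorgiWan2024, §4.1] -/
theorem gwAng_nonneg (hM : 0 < M) {r : ℝ} (hr : M ≤ r) : 0 ≤ gwAng M r := by
  have hx : 0 ≤ r - M := sub_nonneg.mpr hr
  unfold gwAng
  positivity

/-- `β ≥ 0`. [cite: GiorgiWan2024, §4.2] -/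
theorem gwBeta_nonneg (hM : 0 ≤ M) (r : ℝ) : 0 ≤ gwBeta M r := by
  unfold gwBeta; positivity

/-- `b ≥ 0`. [cite: GiorgiWan2024, §4.2] -/
theorem gwBump_nonneg (hM : 0 ≤ M) (r : ℝ) : 0 ≤ gwBump M r := by
  unfold gwBump; positivity

/-- The `G_t²`-coefficient is non-negative on `r ≥ M`, `c² ≤ 1`. [cite: GiorgiWan2024, §4.2] -/
theorem gwT_coeff_nonneg (hM : 0 < M) {r c : ℝ} (hr : M ≤ r) (hc : c ^ 2 ≤ 1) :
    0 ≤ gwAng M r * (M ^ 2 * (1 - c ^ 2)) + 4 * M ^ 2 * r ^ 2 * gwBeta M r +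
      (r ^ 2 + M ^ 2 * c ^ 2 + 2 * M * r) * gwBump M r := by
  have h1 : 0 ≤ 1 - c ^ 2 := sub_nonneg.mpr hc
  have hr0 : 0 ≤ r := hM.le.trans hr
  have := gwAng_nonneg hM hr
  have := gwBeta_nonneg hM.le r
  have := gwBump_nonneg hM.le r
  positivity

/-- **The total bulk form is non-negative on the exterior**: `gwQuad ≥ 0` for `r ≥ M`, `c² ≤ 1`
(all `G, G_t, G_r, G_θ`). [cite: GiorgiWan2024, Thm. 1.1 and §4.2] -/
theorem gwQuad_nonneg (hM : 0 < M) {r c : ℝ} (hr : M ≤ r) (hc : c ^ 2 ≤ 1) (G G₀ G₁ G₂ : ℝ) :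
    0 ≤ gwQuad M r c G G₀ G₁ G₂ := by
  rw [gwQuad_eq_blocks]
  have h1 : 0 ≤ 1 / 10 * gwF M r * ((r - M) ^ 2 * G₁ + 2 * M * r * G₀) ^ 2 := by
    have := gwF_nonneg hM hr; positivity
  have h2 := gwBlock_nonneg hM hr hc ((r - M) ^ 2 * G₁ + 2 * M * r * G₀) G
  have h3 : 0 ≤ (gwAng M r - gwBump M r) * G₂ ^ 2 :=
    mul_nonneg (gwAng_sub_gwBump_nonneg hM hr) (sq_nonneg _)
  have h4 : 0 ≤ (gwAng M r * (M ^ 2 * (1 - c ^ 2)) + 4 * M ^ 2 * r ^ 2 * gwBeta M r +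
      (r ^ 2 + M ^ 2 * c ^ 2 + 2 * M * r) * gwBump M r) * G₀ ^ 2 :=
    mul_nonneg (gwT_coeff_nonneg hM hr hc) (sq_nonneg _)
  linarith

/-- **The total bulk is non-negative on the exterior** (`r ≥ M`, `θ ∈ [0, π]`, `M > 0`).
[cite: GiorgiWan2024, Thm. 1.1] -/
theorem gwGood_nonneg (hM : 0 < M) {G : E4 → ℝ} {q : E4} (hr : M ≤ q 1) (hθ : q 2 ∈ Icc 0 π) :
    0 ≤ -multBulk M M (mzProfileR M (gwSeed M)) (mzProfileT M (gwSeed M)) (gwLag M) G q +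
        jBulk M (gwJ M) (gwJ₁ M) G q := by
  rw [gwGood_eq hM.ne']
  have hs : 0 ≤ sin (q 2) := sin_nonneg_of_nonneg_of_le_pi hθ.1 hθ.2
  have hc : cos (q 2) ^ 2 ≤ 1 := by nlinarith [sin_sq_add_cos_sq (q 2), sq_nonneg (sin (q 2))]
  exact mul_nonneg hs (gwQuad_nonneg hM hr hc _ _ _ _)

end Positivity

/-! ### Coercivity on the transition slab `23M/21 ≤ r ≤ 8M/7` -/

section Slab

variable {M : ℝ}

/-- Elementary bounds on the slab. [folklore] -/
theorem slab_elem (hM : 0 < M) {r : ℝ} (hr : r ∈ Icc (23 / 21 * M) (8 / 7 * M)) :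
    2 / 21 * M ≤ r - M ∧ r - M ≤ M / 7 ∧ r ^ 2 + M ^ 2 ≤ 113 / 49 * M ^ 2 ∧
      970 / 441 * M ^ 2 ≤ r ^ 2 + M ^ 2 ∧ M ≤ r ∧ 0 ≤ r := by
  obtain ⟨h1, h2⟩ := hr
  refine ⟨by linarith, by linarith, by nlinarith, by nlinarith, by linarith, by linarith⟩

/-- `f'/R2 ≥ 3/(10M³)` on the slab. [cite: GiorgiWan2024, §4.1] -/
theorem gwF_slab (hM : 0 < M) {r : ℝ} (hr : r ∈ Icc (23 / 21 * M) (8 / 7 * M)) :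
    3 / (10 * M ^ 3) ≤ gwF M r := by
  obtain ⟨hx1, -, hR2, -, hMr, hr0⟩ := slab_elem hM hr
  have hR := R2_pos hM.ne' r
  have hM3 : 0 < 10 * M ^ 3 := by positivity
  unfold gwF
  rw [div_le_div_iff₀ hM3 (pow_pos hR 3)]
  have hcube : (r ^ 2 + M ^ 2) ^ 3 ≤ (113 / 49 * M ^ 2) ^ 3 :=
    pow_le_pow_left₀ hR.le hR2 3
  have hnum : 2 * M ^ 2 ≤ r ^ 2 + 2 * M * r - M ^ 2 := by nlinarith
  nlinarith [pow_pos hM 6, pow_pos hM 3]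

/-- `αN ≤ 11M⁵` on the slab. [cite: GiorgiWan2024, §4.2] -/
theorem gwAlphaN_slab (hM : 0 < M) {r : ℝ} (hr : r ∈ Icc (23 / 21 * M) (8 / 7 * M)) :
    gwAlphaN M r ≤ 11 * M ^ 5 := by
  obtain ⟨hx1, hx2, -, -, -, -⟩ := slab_elem hM hr
  have hx0 : 0 ≤ r - M := by linarith
  have h : gwAlphaN M r = 7 * M ^ 5 + 108 / 5 * M ^ 4 * (r - M) + 109 / 5 * M ^ 3 * (r - M) ^ 2 +
      54 / 5 * M ^ 2 * (r - M) ^ 3 + 7 / 4 * M * (r - M) ^ 4 := by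
    unfold gwAlphaN; ring
  rw [h]
  have hp2 : (r - M) ^ 2 ≤ (M / 7) ^ 2 := pow_le_pow_left₀ hx0 hx2 2
  have hp3 : (r - M) ^ 3 ≤ (M / 7) ^ 3 := pow_le_pow_left₀ hx0 hx2 3
  have hp4 : (r - M) ^ 4 ≤ (M / 7) ^ 4 := pow_le_pow_left₀ hx0 hx2 4
  nlinarith [pow_pos hM 2, pow_pos hM 3, pow_pos hM 4, pow_pos hM 5]

/-- The discriminant numerator is at least `5M¹⁶` on the slab. [cite: GiorgiWan2024, §4.2] -/
theorem gwCertN_slab (hM : 0 < M) {r Sig : ℝ} (hr : r ∈ Icc (23 / 21 * M) (8 / 7 * M))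
    (h₁ : r ^ 2 ≤ Sig) (h₂ : Sig ≤ r ^ 2 + M ^ 2) : 5 * M ^ 16 ≤ gwCertN M r Sig := by
  obtain ⟨hx1, -, -, -, hMr, -⟩ := slab_elem hM hr
  have hx0 : 0 ≤ r - M := by linarith
  have hsq : (2 / 21 * M) ^ 2 ≤ (r - M) ^ 2 := pow_le_pow_left₀ (by positivity) hx1 2
  -- lower bounds for the two certificates from their first terms
  have hL : 5 * M ^ 16 ≤ gwCertLow M r := by
    have htail : 0 ≤ gwCertLow M r - 3031 / 5 * M ^ 14 * (r - M) ^ 2 := by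
      have h : gwCertLow M r - 3031 / 5 * M ^ 14 * (r - M) ^ 2 =
          55934 / 25 * M ^ 13 * (r - M) ^ 3 + 74294 / 25 * M ^ 12 * (r - M) ^ 4 +
          79323 / 25 * M ^ 11 * (r - M) ^ 5 + 134891 / 20 * M ^ 10 * (r - M) ^ 6 + 64008 / 5 * M ^ 9 * (r - M) ^ 7 +
          75276 / 5 * M ^ 8 * (r - M) ^ 8 + 283447 / 25 * M ^ 7 * (r - M) ^ 9 + 572421 / 100 * M ^ 6 * (r - M) ^ 10 +
          49578 / 25 * M ^ 5 * (r - M) ^ 11 + 23437 / 50 * M ^ 4 * (r - M) ^ 12 + 1679 / 25 * M ^ 3 * (r - M) ^ 13 +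
          77 / 20 * M ^ 2 * (r - M) ^ 14 := by
        unfold gwCertLow; ring
      rw [h]; positivity
    nlinarith [pow_pos hM 14]
  have hH : 5 * M ^ 16 ≤ gwCertHigh M r := by
    have htail : 0 ≤ gwCertHigh M r - 5236 / 5 * M ^ 14 * (r - M) ^ 2 := by
      have h : gwCertHigh M r - 5236 / 5 * M ^ 14 * (r - M) ^ 2 =
          123344 / 25 * M ^ 13 * (r - M) ^ 3 + 234524 / 25 * M ^ 12 * (r - M) ^ 4 +
          250648 / 25 * M ^ 11 * (r - M) ^ 5 + 38138 / 5 * M ^ 10 * (r - M) ^ 6 + 29988 / 5 * M ^ 9 * (r - M) ^ 7 +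
          28236 / 5 * M ^ 8 * (r - M) ^ 8 + 119682 / 25 * M ^ 7 * (r - M) ^ 9 + 303621 / 100 * M ^ 6 * (r - M) ^ 10 +
          34108 / 25 * M ^ 5 * (r - M) ^ 11 + 40749 / 100 * M ^ 4 * (r - M) ^ 12 + 1679 / 25 * M ^ 3 * (r - M) ^ 13 +
          77 / 20 * M ^ 2 * (r - M) ^ 14 := by
        unfold gwCertHigh; ring
      rw [h]; positivity
    nlinarith [pow_pos hM 14]
  -- interpolate
  have h := gwCertN_interp M r Sig
  rw [gwCertN_low, gwCertN_high] at h
  have hA : 0 ≤ r ^ 2 + M ^ 2 - Sig := sub_nonneg.mpr h₂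
  have hB : 0 ≤ Sig - r ^ 2 := sub_nonneg.mpr h₁
  have hC : 0 ≤ 49 / 4 * M ^ 4 * r ^ 4 * (r - M) ^ 2 * (r ^ 2 + M ^ 2) ^ 2 * (Sig - r ^ 2) * (r ^ 2 + M ^ 2 - Sig) := by
    positivity
  have hM2 : 0 < M ^ 2 := by positivity
  nlinarith [mul_le_mul_of_nonneg_left hL hA, mul_le_mul_of_nonneg_left hH hB]

/-- The `G²`-coefficient left after completing the square is at least `1/(2000M)` on the slab.
[cite: GiorgiWan2024, §4.2] -/
theorem gwS_slab (hM : 0 < M) {r c : ℝ} (hr : r ∈ Icc (23 / 21 * M) (8 / 7 * M)) (hc : c ^ 2 ≤ 1) :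
    1 / (2000 * M) ≤ (4 * gwAlpha M r * gwGamma M r c - gwKappa M r c ^ 2) / (4 * gwAlpha M r) := by
  obtain ⟨-, -, hR2, -, hMr, -⟩ := slab_elem hM hr
  have hR := R2_pos hM.ne' r
  have h₁ : r ^ 2 ≤ r ^ 2 + M ^ 2 * c ^ 2 := by nlinarith [sq_nonneg c, sq_nonneg M]
  have h₂ : r ^ 2 + M ^ 2 * c ^ 2 ≤ r ^ 2 + M ^ 2 := by nlinarith [hc, sq_nonneg M]
  have hN := gwCertN_slab hM hr h₁ h₂
  have hαN := gwAlphaN_slab hM hr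
  have hαNpos := gwAlphaN_pos hM hMr
  have hR6 : (r ^ 2 + M ^ 2) ^ 6 ≤ (113 / 49 * M ^ 2) ^ 6 := pow_le_pow_left₀ hR.le hR2 6
  rw [gwDisc_eq hM.ne', gwAlpha_eq hM.ne']
  have hden : 0 < 4 * (gwAlphaN M r / (r ^ 2 + M ^ 2) ^ 4) := by positivity
  rw [div_le_div_iff₀ (by positivity) hden]
  -- `(r²+M²)¹⁰ = (r²+M²)⁴ (r²+M²)⁶`
  have hsplit : gwCertN M r (r ^ 2 + M ^ 2 * c ^ 2) / (r ^ 2 + M ^ 2) ^ 10 * (2000 * M) =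
      gwCertN M r (r ^ 2 + M ^ 2 * c ^ 2) * (2000 * M) / ((r ^ 2 + M ^ 2) ^ 4 * (r ^ 2 + M ^ 2) ^ 6) := by
    rw [← pow_add]; ring
  rw [hsplit, le_div_iff₀ (by positivity)]
  have hR4 : 0 < (r ^ 2 + M ^ 2) ^ 4 := by positivity
  -- reduce to `4 αN R2⁶ ≤ 2000 M · certN`
  have key : 4 * gwAlphaN M r * (r ^ 2 + M ^ 2) ^ 6 ≤ gwCertN M r (r ^ 2 + M ^ 2 * c ^ 2) * (2000 * M) := by
    have h113 : (113 / 49 * M ^ 2 : ℝ) ^ 6 ≤ 162 * M ^ 12 := by nlinarith [pow_pos hM 12]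
    nlinarith [mul_le_mul hαN (hR6.trans h113) (by positivity) (by positivity), pow_pos hM 17, pow_pos hM 5]
  calc 1 * (4 * (gwAlphaN M r / (r ^ 2 + M ^ 2) ^ 4)) * ((r ^ 2 + M ^ 2) ^ 4 * (r ^ 2 + M ^ 2) ^ 6)
      = 4 * gwAlphaN M r * (r ^ 2 + M ^ 2) ^ 6 := by field_simp
    _ ≤ gwCertN M r (r ^ 2 + M ^ 2 * c ^ 2) * (2000 * M) := key

/-- `A − b ≥ 1/(50M)` on the slab. [cite: GiorgiWan2024, §4.1–4.2] -/
theorem gwAngBump_slab (hM : 0 < M) {r : ℝ} (hr : r ∈ Icc (23 / 21 * M) (8 / 7 * M)) :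
    1 / (50 * M) ≤ gwAng M r - gwBump M r := by
  obtain ⟨hx1, hx2, hR2, hR2', hMr, hr0⟩ := slab_elem hM hr
  have hR := R2_pos hM.ne' r
  have h : gwAng M r - gwBump M r =
      (r - M) * (r ^ 2 - 2 * M * r - M ^ 2) ^ 2 * (r ^ 2 + M ^ 2 - M / 20 * (r - M)) / (r ^ 2 + M ^ 2) ^ 4 := by
    simp only [gwAng, gwBump]
    field_simp
  rw [h, div_le_div_iff₀ (by positivity) (pow_pos hR 4)]
  have hx0 : 0 ≤ r - M := by linarith
  -- the factors
  have hP : r ^ 2 - 2 * M * r - M ^ 2 ≤ -(97 / 49) * M ^ 2 := by nlinarith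
  have hP2 : (97 / 49 * M ^ 2) ^ 2 ≤ (r ^ 2 - 2 * M * r - M ^ 2) ^ 2 := by nlinarith
  have hQ : 219 / 100 * M ^ 2 ≤ r ^ 2 + M ^ 2 - M / 20 * (r - M) := by nlinarith
  have hR4 : (r ^ 2 + M ^ 2) ^ 4 ≤ (113 / 49 * M ^ 2) ^ 4 := pow_le_pow_left₀ hR.le hR2 4
  have h1 : 2 / 21 * M * (97 / 49 * M ^ 2) ^ 2 ≤ (r - M) * (r ^ 2 - 2 * M * r - M ^ 2) ^ 2 :=
    mul_le_mul hx1 hP2 (by positivity) hx0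
  have h2 : 2 / 21 * M * (97 / 49 * M ^ 2) ^ 2 * (219 / 100 * M ^ 2) ≤
      (r - M) * (r ^ 2 - 2 * M * r - M ^ 2) ^ 2 * (r ^ 2 + M ^ 2 - M / 20 * (r - M)) :=
    mul_le_mul h1 hQ (by positivity) (by positivity)
  nlinarith [pow_pos hM 8, pow_pos hM 7]

/-- The `G_t²`-coefficient is at least `M/50` on the slab. [cite: GiorgiWan2024, §4.2] -/
theorem gwT_slab (hM : 0 < M) {r c : ℝ} (hr : r ∈ Icc (23 / 21 * M) (8 / 7 * M)) (hc : c ^ 2 ≤ 1) :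
    M / 50 ≤ gwAng M r * (M ^ 2 * (1 - c ^ 2)) + 4 * M ^ 2 * r ^ 2 * gwBeta M r +
      (r ^ 2 + M ^ 2 * c ^ 2 + 2 * M * r) * gwBump M r := by
  obtain ⟨hx1, hx2, hR2, hR2', hMr, hr0⟩ := slab_elem hM hr
  have hR := R2_pos hM.ne' r
  have hA : 0 ≤ gwAng M r * (M ^ 2 * (1 - c ^ 2)) :=
    mul_nonneg (gwAng_nonneg hM hMr) (mul_nonneg (sq_nonneg _) (sub_nonneg.mpr hc))
  have hB : 0 ≤ (r ^ 2 + M ^ 2 * c ^ 2 + 2 * M * r) * gwBump M r :=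
    mul_nonneg (by positivity) (gwBump_nonneg hM.le r)
  have hmain : M / 50 ≤ 4 * M ^ 2 * r ^ 2 * gwBeta M r := by
    unfold gwBeta
    have heq : 4 * M ^ 2 * r ^ 2 * (M / 20 * (r ^ 2 - 2 * M * r - M ^ 2) ^ 2 / (r ^ 2 + M ^ 2) ^ 4) =
        M ^ 3 * r ^ 2 * (r ^ 2 - 2 * M * r - M ^ 2) ^ 2 / 5 / (r ^ 2 + M ^ 2) ^ 4 := by ring
    rw [heq, le_div_iff₀ (pow_pos hR 4)]
    have hP : r ^ 2 - 2 * M * r - M ^ 2 ≤ -(97 / 49) * M ^ 2 := by nlinarith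
    have hP2 : (97 / 49 * M ^ 2) ^ 2 ≤ (r ^ 2 - 2 * M * r - M ^ 2) ^ 2 := by nlinarith
    have hr2 : (23 / 21 * M) ^ 2 ≤ r ^ 2 := pow_le_pow_left₀ (by positivity) hr.1 2
    have hR4 : (r ^ 2 + M ^ 2) ^ 4 ≤ (113 / 49 * M ^ 2) ^ 4 := pow_le_pow_left₀ hR.le hR2 4
    have h1 : (23 / 21 * M) ^ 2 * (97 / 49 * M ^ 2) ^ 2 ≤ r ^ 2 * (r ^ 2 - 2 * M * r - M ^ 2) ^ 2 :=
      mul_le_mul hr2 hP2 (by positivity) (by positivity)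
    nlinarith [pow_pos hM 3, pow_pos hM 9, mul_le_mul_of_nonneg_left h1 (le_of_lt (pow_pos hM 3))]
  linarith

/-- **Coercivity of the total bulk form on the slab**: for `23M/21 ≤ r ≤ 8M/7`, `c² ≤ 1`,
`gwQuad ≥ 10⁻⁸M⁻²(MG² + M³(G_t² + G_r²) + MG_θ²)`. [cite: GiorgiWan2024, Cor. 1.2] -/
theorem gwQuad_slab (hM : 0 < M) {r c : ℝ} (hr : r ∈ Icc (23 / 21 * M) (8 / 7 * M)) (hc : c ^ 2 ≤ 1)
    (G G₀ G₁ G₂ : ℝ) :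
    1 / 10 ^ 8 / M ^ 2 * (M * G ^ 2 + M ^ 3 * (G₀ ^ 2 + G₁ ^ 2) + M * G₂ ^ 2) ≤ gwQuad M r c G G₀ G₁ G₂ := by
  obtain ⟨hx1, -, -, -, hMr, hr0⟩ := slab_elem hM hr
  rw [gwQuad_eq_blocks]
  obtain ⟨X, hX⟩ : ∃ X, (r - M) ^ 2 * G₁ + 2 * M * r * G₀ = X := ⟨_, rfl⟩
  rw [hX]
  have hG1 : 0 ≤ G₁ ^ 2 := sq_nonneg _
  have hG0 : 0 ≤ G₀ ^ 2 := sq_nonneg _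
  have hG2 : 0 ≤ G₂ ^ 2 := sq_nonneg _
  have hGG : 0 ≤ G ^ 2 := sq_nonneg _
  have hXX : 0 ≤ X ^ 2 := sq_nonneg _
  have hM3 : 0 < M ^ 3 := pow_pos hM 3
  -- the four coefficient bounds
  have hF := gwF_slab hM hr
  have hS := (mul_le_mul_of_nonneg_right (gwS_slab hM hr hc) hGG).trans (gwBlock_ge hM c hMr X G)
  have hABG : 1 / (50 * M) * G₂ ^ 2 ≤ (gwAng M r - gwBump M r) * G₂ ^ 2 :=
    mul_le_mul_of_nonneg_right (gwAngBump_slab hM hr) hG2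
  have hTG : M / 50 * G₀ ^ 2 ≤ (gwAng M r * (M ^ 2 * (1 - c ^ 2)) + 4 * M ^ 2 * r ^ 2 * gwBeta M r +
      (r ^ 2 + M ^ 2 * c ^ 2 + 2 * M * r) * gwBump M r) * G₀ ^ 2 :=
    mul_le_mul_of_nonneg_right (gwT_slab hM hr hc) hG0
  -- the first square: `X² ≥ ½((r−M)²G_r)² − (2MrG_t)²`, used with one tenth of the available weight
  have hsq : 1 / 2 * ((r - M) ^ 2 * G₁) ^ 2 - (2 * M * r * G₀) ^ 2 ≤ X ^ 2 := by
    rw [← hX]; nlinarith [sq_nonneg ((r - M) ^ 2 * G₁ + 2 * (2 * M * r * G₀))]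
  have h3pos : 0 ≤ 3 / (1000 * M ^ 3) := by positivity
  have h1 : 3 / (1000 * M ^ 3) * (1 / 2 * ((r - M) ^ 2 * G₁) ^ 2 - (2 * M * r * G₀) ^ 2) ≤
      1 / 10 * gwF M r * X ^ 2 := by
    have hA := mul_le_mul_of_nonneg_left hsq h3pos
    have hB : 3 / (10 * M ^ 3) * X ^ 2 ≤ gwF M r * X ^ 2 := mul_le_mul_of_nonneg_right hF hXX
    have hE : 3 / (1000 * M ^ 3) * X ^ 2 = 1 / 100 * (3 / (10 * M ^ 3) * X ^ 2) := by ring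
    have hpos : 0 ≤ 3 / (10 * M ^ 3) * X ^ 2 := by positivity
    linarith
  -- `G_r²`: `(3/2000)(r−M)⁴/M³ ≥ 10⁻⁸ M`
  have e1 : 1 / 10 ^ 8 * M * G₁ ^ 2 ≤ 3 / (1000 * M ^ 3) * (1 / 2 * ((r - M) ^ 2 * G₁) ^ 2) := by
    have heq : 3 / (1000 * M ^ 3) * (1 / 2 * ((r - M) ^ 2 * G₁) ^ 2) =
        3 / 2000 * ((r - M) ^ 4 / M ^ 3) * G₁ ^ 2 := by
      field_simp
      ring
    rw [heq]
    have hx4 : (2 / 21 * M) ^ 4 ≤ (r - M) ^ 4 := pow_le_pow_left₀ (by positivity) hx1 4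
    have hq : 16 / 194481 * M ≤ (r - M) ^ 4 / M ^ 3 := by
      rw [le_div_iff₀ hM3]
      have : (2 / 21 * M) ^ 4 = 16 / 194481 * M * M ^ 3 := by ring
      linarith
    have h' := mul_le_mul_of_nonneg_right hq hG1
    have hMG : 0 ≤ M * G₁ ^ 2 := by positivity
    linarith
  -- `G_t²` loss from the first square: `(3/(1000M³))(2MrG_t)² ≤ (768/49000) M G_t²`
  have e2 : 3 / (1000 * M ^ 3) * (2 * M * r * G₀) ^ 2 ≤ 768 / 49000 * M * G₀ ^ 2 := by
    have heq : 3 / (1000 * M ^ 3) * (2 * M * r * G₀) ^ 2 = 12 / 1000 * (r ^ 2 / M) * G₀ ^ 2 := by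
      field_simp
      ring
    rw [heq]
    have hq : r ^ 2 / M ≤ 64 / 49 * M := by
      rw [div_le_iff₀ hM]
      have hr2 : r ^ 2 ≤ (8 / 7 * M) ^ 2 := pow_le_pow_left₀ hr0 hr.2 2
      linarith
    have h' := mul_le_mul_of_nonneg_right hq hG0
    linarith
  -- `G²` and `G_θ²`: `1/(2000M), 1/(50M) ≥ 10⁻⁸/M`
  have e3 : 1 / 10 ^ 8 / M * G ^ 2 ≤ 1 / (2000 * M) * G ^ 2 := by
    apply mul_le_mul_of_nonneg_right _ hGG
    rw [div_div, div_le_div_iff₀ (by positivity) (by positivity)]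
    linarith
  have e4 : 1 / 10 ^ 8 / M * G₂ ^ 2 ≤ 1 / (50 * M) * G₂ ^ 2 := by
    apply mul_le_mul_of_nonneg_right _ hG2
    rw [div_div, div_le_div_iff₀ (by positivity) (by positivity)]
    linarith
  have target : 1 / 10 ^ 8 / M ^ 2 * (M * G ^ 2 + M ^ 3 * (G₀ ^ 2 + G₁ ^ 2) + M * G₂ ^ 2) =
      1 / 10 ^ 8 / M * G ^ 2 + 1 / 10 ^ 8 * M * G₀ ^ 2 + 1 / 10 ^ 8 * M * G₁ ^ 2 + 1 / 10 ^ 8 / M * G₂ ^ 2 := by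
    field_simp
    ring
  rw [target]
  have hMG0 : 0 ≤ M * G₀ ^ 2 := by positivity
  linarith

/-- **Coercivity of the total bulk on the slab**: for `23M/21 ≤ q 1 ≤ 8M/7`, `θ ∈ [0, π]`,
`−multBulk + jBulk ≥ 10⁻⁸M⁻² sin θ (MG² + M³((∂_{t*}G)² + (∂_rG)²) + M(∂_θG)²)`.
[cite: GiorgiWan2024, Cor. 1.2] -/
theorem gwGood_slab (hM : 0 < M) {G : E4 → ℝ} {q : E4} (hr : q 1 ∈ Icc (23 / 21 * M) (8 / 7 * M))
    (hθ : q 2 ∈ Icc 0 π) :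
    1 / 10 ^ 8 / M ^ 2 * (sin (q 2) * (M * G q ^ 2 + M ^ 3 * (pd 0 G q ^ 2 + pd 1 G q ^ 2) + M * pd 2 G q ^ 2)) ≤
      -multBulk M M (mzProfileR M (gwSeed M)) (mzProfileT M (gwSeed M)) (gwLag M) G q +
        jBulk M (gwJ M) (gwJ₁ M) G q := by
  rw [gwGood_eq hM.ne']
  have hs : 0 ≤ sin (q 2) := sin_nonneg_of_nonneg_of_le_pi hθ.1 hθ.2
  have hc : cos (q 2) ^ 2 ≤ 1 := by nlinarith [sin_sq_add_cos_sq (q 2), sq_nonneg (sin (q 2))]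
  have h := gwQuad_slab hM hr hc (G q) (pd 0 G q) (pd 1 G q) (pd 2 G q)
  have := mul_le_mul_of_nonneg_left h hs
  linarith [this]

end Slab

/-! ### Values on the horizon and smoothness of `ṽ'` (v2) -/

section HorizonValues

variable {M : ℝ}

/-- The seed on the horizon: `f(M) = −1`. [cite: GiorgiWan2024, §4.1] -/
theorem gwSeed_horizon (hM : M ≠ 0) : gwSeed M M = -1 := by
  have h2 : (2 : ℝ) * M ^ 2 ≠ 0 := by positivity
  simp only [gwSeed]
  field_simp
  ring

/-- The `∂_r`-profile vanishes on the horizon and the `∂_{t*}`-profile is `−1` there (so the horizon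
flux of the current is minus the `T`-flux). [cite: GiorgiWan2024, §4.1] -/
theorem gwProfiles_horizon (hM : M ≠ 0) :
    mzProfileR M (gwSeed M) M = 0 ∧ mzProfileT M (gwSeed M) M = -1 := by
  have h2 : (2 : ℝ) * M ^ 2 ≠ 0 := by positivity
  constructor
  · simp [mzProfileR]
  · simp only [mzProfileT, gwSeed]
    field_simp
    ring

/-- `ṽ' = gwJ₁` is smooth. [folklore] -/
theorem contDiff_gwJ₁' (hM : M ≠ 0) : ContDiff ℝ ∞ (gwJ₁ M) := by
  unfold gwJ₁
  fun_prop (disch := intro x; exact pow_ne_zero _ (R2_pos hM x).ne')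

end HorizonValues

end StarCoord

end Kerr

end Literature.Geometry.Lorentzian

end
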